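import Summits.Ventures.PercRepro.C026C028Pendant

/-!
# Series reduction at a non-mark of degree two (p6, gen 15; mine-3 MINE3-GLUING §2, series edges)

If the non-mark `y` carries exactly two edges that are not surely closed, `e = {x, y}` and
`g = {y, w}`, then for the connections among the other vertices the pair acts as a single edge `x`–`w`
open with probability `p e · p g`: every row at marks `≠ y` under `p` equals the row under
`p[e:=1][g := p e · p g]` (`law3_series`).  The latter weight vector has one fractional edge fewer when
`0 < p g < 1` (`fracEdges_series_subset`), so in the one-edge induction for C-028(c) the step at such an
edge is free (`C028At_series`): step (A) is only ever needed at a non-mark of degree `≥ 3`.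
-/

namespace PercRepro

open Finset

namespace MultiGraph

variable {V E : Type*} (G : MultiGraph V E) [Fintype E] [DecidableEq E]

/-- **Series reduction of the rows**: with `e = {x, y}`, `g = {y, w}` the only edges at `y` not surely
closed, `law3 p = law3 (p[e:=1][g := p e · p g])` at marks `≠ y`. -/
theorem law3_series {p : E → ℝ} (hp : IsProb p) {e g : E} (heg : e ≠ g) {y : V}
    (hye : G.fst e = y ∨ G.snd e = y) (hyg : G.fst g = y ∨ G.snd g = y)
    (hpend : ∀ e', e' ≠ e → e' ≠ g → (G.fst e' = y ∨ G.snd e' = y) → p e' = 0) {a b c : V}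
    (ha : a ≠ y) (hb : b ≠ y) (hc : c ≠ y) (s : Fin 5) :
    G.law3 p a b c s =
      G.law3 (Function.update (Function.update p e 1) g (p e * p g)) a b c s := by
  have hp1 : IsProb (Function.update p e 1) := hp.update e ⟨zero_le_one, le_rfl⟩
  have hp0 : IsProb (Function.update p e 0) := hp.update e ⟨le_rfl, zero_le_one⟩
  have hpg0 : IsProb (Function.update p g 0) := hp.update g ⟨le_rfl, zero_le_one⟩
  -- under `p[g:=0]`, `y` is pendant at `e`
  have hpendE : ∀ e', e' ≠ e → (G.fst e' = y ∨ G.snd e' = y) → Function.update p g 0 e' = 0 := by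
    intro e' he' hy'
    by_cases h : e' = g
    · subst h; simp
    · rw [Function.update_of_ne h]
      exact hpend e' he' h hy'
  -- under `p[e:=0]`, `y` is pendant at `g`
  have hpendG : ∀ e', e' ≠ g → (G.fst e' = y ∨ G.snd e' = y) → Function.update p e 0 e' = 0 := by
    intro e' he' hy'
    by_cases h : e' = e
    · subst h; simp
    · rw [Function.update_of_ne h]
      exact hpend e' h he' hy'
  have hL10 := G.law3_update_one_eq_update_zero_of_pendant hpg0 hye hpendE ha hb hc s
  have hL01 := G.law3_update_one_eq_update_zero_of_pendant hp0 hyg hpendG ha hb hc s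
  -- rewrite the updates into a common order `p[e:=·][g:=·]`
  rw [Function.update_comm heg.symm, Function.update_comm heg.symm] at hL10
  have hsplitE := G.law3_split_edge p e a b c s
  have hsplitG0 := G.law3_split_edge (Function.update p e 0) g a b c s
  have hsplitG1 := G.law3_split_edge (Function.update p e 1) g a b c s
  have hsplitG' := G.law3_split_edge (Function.update (Function.update p e 1) g (p e * p g)) g a b c s
  rw [Function.update_idem, Function.update_idem, Function.update_self] at hsplitG'
  rw [Function.update_of_ne heg.symm] at hsplitG0 hsplitG1
  rw [hsplitG', hsplitE, hsplitG1, hsplitG0, hL01, hL10]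
  ring

/-- The series-reduced weight vector has the fractional edges of `p` minus `e` (when `g` is fractional
or surely closed). -/
theorem fracEdges_series_subset (p : E → ℝ) {e g : E} (heg : e ≠ g) (hg : p g ≠ 1) :
    fracEdges (Function.update (Function.update p e 1) g (p e * p g)) ⊆ (fracEdges p).erase e := by
  intro e' he'
  simp only [fracEdges, Finset.mem_filter, Finset.mem_univ, true_and] at he'
  by_cases h1 : e' = g
  · subst h1
    rw [Function.update_self] at he'
    simp only [Finset.mem_erase, fracEdges, Finset.mem_filter, Finset.mem_univ, true_and]
    refine ⟨heg.symm, fun h0 => he'.1 (by rw [h0, mul_zero]), hg⟩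
  · rw [Function.update_of_ne h1] at he'
    by_cases h2 : e' = e
    · subst h2
      rw [Function.update_self] at he'
      exact absurd rfl he'.2
    · rw [Function.update_of_ne h2] at he'
      simp only [Finset.mem_erase, fracEdges, Finset.mem_filter, Finset.mem_univ, true_and]
      exact ⟨h2, he'⟩

/-- The series reduction strictly decreases the number of fractional edges. -/
theorem card_fracEdges_series_lt {p : E → ℝ} {e g : E} (heg : e ≠ g) (he : e ∈ fracEdges p)
    (hg : p g ≠ 1) :
    (fracEdges (Function.update (Function.update p e 1) g (p e * p g))).card <
      (fracEdges p).card :=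
  lt_of_le_of_lt (Finset.card_le_card (fracEdges_series_subset p heg hg))
    (Finset.card_erase_lt_of_mem he)

/-- **C-028(c) through a series pair**: C-028(c) at the series-reduced weights gives C-028(c) at `p`. -/
theorem C028At_series {p : E → ℝ} (hp : IsProb p) {e g : E} (heg : e ≠ g) {y : V}
    (hye : G.fst e = y ∨ G.snd e = y) (hyg : G.fst g = y ∨ G.snd g = y)
    (hpend : ∀ e', e' ≠ e → e' ≠ g → (G.fst e' = y ∨ G.snd e' = y) → p e' = 0) {a b c : V}
    (ha : a ≠ y) (hb : b ≠ y) (hc : c ≠ y)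
    (h : G.C028At (Function.update (Function.update p e 1) g (p e * p g)) a b c) :
    G.C028At p a b c := by
  have hr := G.law3_series hp heg hye hyg hpend ha hb hc
  unfold C028At c028Cov at h ⊢
  rw [hr 0, hr 1, hr 2, hr 3]
  exact h

/-! ### The series reduction for a sure cluster of degree two -/

omit [Fintype E] in
/-- `SureConn` is unchanged by setting a non-sure edge to `0` (both directions). -/
theorem sureConn_update_zero_iff {p : E → ℝ} {e : E} (he : p e ≠ 1) (u v : V) :
    G.SureConn (Function.update p e 0) u v ↔ G.SureConn p u v := by
  unfold SureConn
  rw [sureConfig_update_zero he]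

/-- **Series reduction for a sure cluster**: if every edge touching the sure cluster of `y` other than
`e = {x, y}` and `g` (touching the cluster) is surely open or surely closed, and `e`, `g` are not
surely open, then for marks outside the cluster `law3 p = law3 (p[e:=1][g := p e · p g])`. -/
theorem law3_series_cluster {p : E → ℝ} (hp : IsProb p) {e g : E} (heg : e ≠ g) (he1 : p e ≠ 1)
    (hg1 : p g ≠ 1) {y : V} (hye : G.fst e = y ∨ G.snd e = y)
    (hyg : G.SureConn p y (G.fst g) ∨ G.SureConn p y (G.snd g))
    (hpend : ∀ e', e' ≠ e → e' ≠ g →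
      (G.SureConn p y (G.fst e') ∨ G.SureConn p y (G.snd e')) → p e' = 0 ∨ p e' = 1)
    {a b c : V} (ha : ¬ G.SureConn p y a) (hb : ¬ G.SureConn p y b) (hc : ¬ G.SureConn p y c)
    (s : Fin 5) :
    G.law3 p a b c s =
      G.law3 (Function.update (Function.update p e 1) g (p e * p g)) a b c s := by
  have hp0 : IsProb (Function.update p e 0) := hp.update e ⟨le_rfl, zero_le_one⟩
  have hpg0 : IsProb (Function.update p g 0) := hp.update g ⟨le_rfl, zero_le_one⟩
  -- under `p[g:=0]` the cluster of `y` is pendant at `e`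
  have hpendE : ∀ e', e' ≠ e →
      (G.SureConn (Function.update p g 0) y (G.fst e') ∨
        G.SureConn (Function.update p g 0) y (G.snd e')) →
      Function.update p g 0 e' = 0 ∨ Function.update p g 0 e' = 1 := by
    intro e' he' hy'
    rw [G.sureConn_update_zero_iff hg1, G.sureConn_update_zero_iff hg1] at hy'
    by_cases h : e' = g
    · subst h; simp
    · rw [Function.update_of_ne h]
      exact hpend e' he' h hy'
  -- under `p[e:=0]` the cluster of `y` is pendant at `g`
  have hpendG : ∀ e', e' ≠ g →
      (G.SureConn (Function.update p e 0) y (G.fst e') ∨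
        G.SureConn (Function.update p e 0) y (G.snd e')) →
      Function.update p e 0 e' = 0 ∨ Function.update p e 0 e' = 1 := by
    intro e' he' hy'
    rw [G.sureConn_update_zero_iff he1, G.sureConn_update_zero_iff he1] at hy'
    by_cases h : e' = e
    · subst h; simp
    · rw [Function.update_of_ne h]
      exact hpend e' h he' hy'
  have hL10 := G.law3_update_one_eq_update_zero_of_pendantCluster hpg0
    (by rw [Function.update_of_ne heg]; exact he1) hye hpendE
    (by rw [G.sureConn_update_zero_iff hg1]; exact ha)
    (by rw [G.sureConn_update_zero_iff hg1]; exact hb)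
    (by rw [G.sureConn_update_zero_iff hg1]; exact hc) s
  -- the end `y'` of `g` in the cluster of `y`
  have hL01 : G.law3 (Function.update (Function.update p e 0) g 1) a b c s =
      G.law3 (Function.update (Function.update p e 0) g 0) a b c s := by
    have key : ∀ y' : V, G.SureConn p y y' → (G.fst g = y' ∨ G.snd g = y') →
        G.law3 (Function.update (Function.update p e 0) g 1) a b c s =
          G.law3 (Function.update (Function.update p e 0) g 0) a b c s := by
      intro y' hyy' hy'
      have htr : ∀ v, G.SureConn (Function.update p e 0) y' v ↔ G.SureConn p y v := by
        intro v
        rw [G.sureConn_update_zero_iff he1]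
        exact ⟨fun h => Conn.trans (show G.Conn (sureConfig p) y y' from hyy') h,
          fun h => Conn.trans (Conn.symm (show G.Conn (sureConfig p) y y' from hyy')) h⟩
      refine G.law3_update_one_eq_update_zero_of_pendantCluster hp0
        (by rw [Function.update_of_ne heg.symm]; exact hg1) hy' ?_
        (by rw [htr]; exact ha) (by rw [htr]; exact hb) (by rw [htr]; exact hc) s
      intro e' he' hy''
      rw [htr, htr, ← G.sureConn_update_zero_iff he1, ← G.sureConn_update_zero_iff he1] at hy''
      exact hpendG e' he' hy''
    rcases hyg with h | h
    · exact key _ h (Or.inl rfl)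
    · exact key _ h (Or.inr rfl)
  rw [Function.update_comm heg.symm, Function.update_comm heg.symm] at hL10
  have hsplitE := G.law3_split_edge p e a b c s
  have hsplitG0 := G.law3_split_edge (Function.update p e 0) g a b c s
  have hsplitG1 := G.law3_split_edge (Function.update p e 1) g a b c s
  have hsplitG' := G.law3_split_edge (Function.update (Function.update p e 1) g (p e * p g)) g a b c s
  rw [Function.update_idem, Function.update_idem, Function.update_self] at hsplitG'
  rw [Function.update_of_ne heg.symm] at hsplitG0 hsplitG1
  rw [hsplitG', hsplitE, hsplitG1, hsplitG0, hL01, hL10]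
  ring

/-- **C-028(c) through a series sure cluster**: C-028(c) at the series-reduced weights gives C-028(c)
at `p`. -/
theorem C028At_series_cluster {p : E → ℝ} (hp : IsProb p) {e g : E} (heg : e ≠ g) (he1 : p e ≠ 1)
    (hg1 : p g ≠ 1) {y : V} (hye : G.fst e = y ∨ G.snd e = y)
    (hyg : G.SureConn p y (G.fst g) ∨ G.SureConn p y (G.snd g))
    (hpend : ∀ e', e' ≠ e → e' ≠ g →
      (G.SureConn p y (G.fst e') ∨ G.SureConn p y (G.snd e')) → p e' = 0 ∨ p e' = 1)
    {a b c : V} (ha : ¬ G.SureConn p y a) (hb : ¬ G.SureConn p y b) (hc : ¬ G.SureConn p y c)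
    (h : G.C028At (Function.update (Function.update p e 1) g (p e * p g)) a b c) :
    G.C028At p a b c := by
  have hr := G.law3_series_cluster hp heg he1 hg1 hye hyg hpend ha hb hc
  unfold C028At c028Cov at h ⊢
  rw [hr 0, hr 1, hr 2, hr 3]
  exact h

end MultiGraph

end PercRepro
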